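import Literature.Geometry.ComplexAnalytic.HolomorphicMorseLemma
import Mathlib.Analysis.SpecialFunctions.Complex.LogDeriv
import Mathlib.Analysis.Analytic.Order
import Mathlib.FieldTheory.IsAlgClosed.Basic
import HarnessLib

/-!
# The holomorphic `m`-th power chart: a function of order `m` at a point is `ũ^m` in a holomorphic coordinate `ũ`

Layer `Literature/Geometry/ComplexAnalytic` (next to `HolomorphicMorseLemma`, the case `m = 2` in several variables).
Theorems only. Written by the prover seat `hodge-nonav-20241-p1` (g18, cell `hodge-nonav`) as the one-variable half of
brick B4a «A₃ normal-form chart» of prover-Bx's programme A₃-TRACE (binder hN `stub_a3NonComm` of crux K1-B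
`VeryGeneralSignCommutatorsInHg`, stmt-HodgeConjecture-19716; memo `HOME/memos/PROGRAMME-A3-TRACE-Bx-g16.md` §3 B4a): after the
splitting lemma the pencil coordinate restricted to the degenerate direction is `F̃(u) = c₀ + u⁴·w(u)`, `w(0) ≠ 0`, and the
quartic normal form `c₀ + ũ⁴` needs the holomorphic coordinate `ũ = u·w(u)^{1/4}`.

**Theorem (normal form of a holomorphic function of one variable at a point of multiplicity `m`; Forster, *Lectures on
Riemann Surfaces*, proof of Thm. 1.8 / Cor. 2.9 "local normal form `F = z^k`"; Milnor, *Singular points of complex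
hypersurfaces*, §1).** *If `φ(u) = φ(0) + u^m w(u)` near `0` with `w` holomorphic and `w(0) ≠ 0` (`m ≥ 1`), there is a
holomorphic coordinate `ũ = Θ(u)` centred at `0` with `φ(u) = φ(0) + ũ^m`.*  Proof: on the neighbourhood where
`w(u)/w(0)` lies in the slit plane, `r(u) := c·exp(log(w(u)/w(0))/m)` (`c^m = w(0)`) is a holomorphic `m`-th root of `w`;
`Θ(u) := u·r(u)` has `Θ'(0) = c ≠ 0`, hence is a chart by the inverse function theorem
(`HolomorphicMorse.exists_openPartialHomeomorph_contDiffOn_symm`).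

* `exists_holomorphicPowChart` — from the factorisation `φ u = φ 0 + u ^ m * w u` on an open `U ∋ 0`;
* `exists_holomorphicPowChart_of_analyticOrderAt` — from `analyticOrderAt (φ − φ 0) 0 = m` (Mathlib's order of vanishing).

Output format = that of `exists_holomorphicMorseChart` (`OpenPartialHomeomorph ℂ ℂ`, `0 ∈ source ⊆ U`, `Θ 0 = 0`, complex
differentiable and real `C^∞` with `C^∞` inverse, the normal form on the source), plus `deriv Θ 0 ^ m = w 0`.

## References

* [Forster1981] O. Forster, Lectures on Riemann Surfaces, GTM 81 (1981), §1 Thm. 1.8 (proof) and §2 Cor. 2.9 (local normal form).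
* [Milnor1968] J. Milnor, Singular Points of Complex Hypersurfaces (1968), §1–§2 (local behaviour of holomorphic functions).
* [ArnoldGuseinZadeVarchenko1985] V. I. Arnold, S. M. Gusein-Zade, A. N. Varchenko, Singularities of Differentiable Maps I, §9.6
  and §11.1 (normal forms `A_k : x^{k+1}`).
-/

noncomputable section

open Complex Set Filter Topology
open scoped ContDiff

namespace Literature.Geometry.ComplexAnalytic

/-- **Holomorphic `m`-th power chart.** If `φ u = φ 0 + u ^ m * w u` on an open `U ∋ 0` with `w` holomorphic on `U` and
`w 0 ≠ 0` (`m ≥ 1`), there is an open partial homeomorphism `Θ` of `ℂ` with `0 ∈ Θ.source ⊆ U`, `Θ 0 = 0`, `Θ` complex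
differentiable and real `C^∞` on its source with real `C^∞` inverse on its target, `(deriv Θ 0) ^ m = w 0`, and
`φ u = φ 0 + (Θ u) ^ m` on `Θ.source`. [cite: Forster1981, §2 Cor. 2.9 (local normal form, proof)]
[cite: ArnoldGuseinZadeVarchenko1985, §11.1 (normal form A_k)] -/
theorem exists_holomorphicPowChart {m : ℕ} (hm : 1 ≤ m) {φ w : ℂ → ℂ} {U : Set ℂ} (hU : IsOpen U)
    (h0 : (0 : ℂ) ∈ U) (hw : DifferentiableOn ℂ w U) (hw0 : w 0 ≠ 0) (hφ : ∀ u ∈ U, φ u = φ 0 + u ^ m * w u) :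
    ∃ Θ : OpenPartialHomeomorph ℂ ℂ,
      (0 : ℂ) ∈ Θ.source ∧ Θ 0 = 0 ∧ Θ.source ⊆ U ∧
      DifferentiableOn ℂ Θ Θ.source ∧ ContDiffOn ℝ ∞ Θ Θ.source ∧ ContDiffOn ℝ ∞ Θ.symm Θ.target ∧
      deriv Θ 0 ^ m = w 0 ∧
      ∀ u ∈ Θ.source, φ u = φ 0 + (Θ u) ^ m := by
  have hm0 : m ≠ 0 := by omega
  have hmC : (m : ℂ) ≠ 0 := Nat.cast_ne_zero.2 hm0
  -- an `m`-th root `c` of `w 0`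
  obtain ⟨c, hc⟩ := IsAlgClosed.exists_pow_nat_eq (w 0) (by omega : 0 < m)
  have hc0 : c ≠ 0 := by
    rintro rfl
    rw [zero_pow hm0] at hc
    exact hw0 hc.symm
  -- the neighbourhood where `w / w 0` lies in the slit plane
  set V : Set ℂ := U ∩ (fun u => w u / w 0) ⁻¹' slitPlane with hV
  have hwc : ContinuousOn (fun u => w u / w 0) U := hw.continuousOn.div_const _
  have hVo : IsOpen V := hwc.isOpen_inter_preimage hU isOpen_slitPlane
  have h0V : (0 : ℂ) ∈ V := ⟨h0, by
    show w 0 / w 0 ∈ slitPlane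
    rw [div_self hw0]; exact one_mem_slitPlane⟩
  have hVU : V ⊆ U := inter_subset_left
  -- the holomorphic `m`-th root `r` of `w` on `V`
  set r : ℂ → ℂ := fun u => c * exp (log (w u / w 0) / m) with hr
  have hrd : DifferentiableOn ℂ r V := by
    have h1 : DifferentiableOn ℂ (fun u => w u / w 0) V := (hw.mono hVU).div_const _
    have h2 : DifferentiableOn ℂ (fun u => log (w u / w 0)) V := h1.clog fun u hu => hu.2
    exact ((h2.div_const (m : ℂ)).cexp).const_mul c
  have hrpow : ∀ u ∈ V, r u ^ m = w u := by
    intro u hu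
    have hne : w u / w 0 ≠ 0 := slitPlane_ne_zero hu.2
    rw [hr]; dsimp only
    rw [mul_pow, hc, ← exp_nat_mul, mul_div_cancel₀ _ hmC, exp_log hne, mul_div_cancel₀ _ hw0]
  have hr0 : r 0 = c := by
    rw [hr]; dsimp only
    rw [div_self hw0, log_one, zero_div, exp_zero, mul_one]
  -- the coordinate `Θ₀ u = u · r u`
  set Θ₀ : ℂ → ℂ := fun u => u * r u with hΘ₀
  have hΘ₀d : DifferentiableOn ℂ Θ₀ V := differentiableOn_id.mul hrd
  have hΘ₀C : ContDiffOn ℂ ∞ Θ₀ V := hΘ₀d.contDiffOn hVo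
  have hΘ₀' : HasDerivAt Θ₀ c 0 := by
    have hrd0 : HasDerivAt r (deriv r 0) 0 := (hrd.differentiableAt (hVo.mem_nhds h0V)).hasDerivAt
    have h := (hasDerivAt_id (0 : ℂ)).mul hrd0
    simp only [id, one_mul, zero_mul, add_zero, hr0] at h
    exact h
  set T : ℂ ≃L[ℂ] ℂ := ContinuousLinearEquiv.unitsEquivAut ℂ (Units.mk0 c hc0) with hT
  have hTf : HasFDerivAt Θ₀ (T : ℂ →L[ℂ] ℂ) 0 := by
    have h := hΘ₀'.hasFDerivAt
    refine h.congr_fderiv (ContinuousLinearMap.ext_ring ?_)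
    rw [hT]
    simp [ContinuousLinearEquiv.unitsEquivAut_apply]
  -- the inverse function theorem
  obtain ⟨G, hGΘ, h0G, hGV, hGC, hGsC, -⟩ :=
    HolomorphicMorse.exists_openPartialHomeomorph_contDiffOn_symm hVo h0V (m := ∞) (by simp) hΘ₀C T hTf
  refine ⟨G, h0G, ?_, hGV.trans hVU, (hGC.differentiableOn (by simp)), hGC.restrict_scalars ℝ,
    hGsC.restrict_scalars ℝ, ?_, fun u hu => ?_⟩
  · rw [hGΘ, hΘ₀]; simp
  · rw [hGΘ, hΘ₀'.deriv, hc]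
  · rw [hGΘ, hφ u (hVU (hGV hu)), hΘ₀]
    dsimp only
    rw [mul_pow, hrpow u (hGV hu)]

/-- **Holomorphic `m`-th power chart from the order of vanishing.** If `φ` is analytic at `0` and `φ − φ(0)` has order exactly
`m ≥ 1` at `0` (Mathlib's `analyticOrderAt`), there is a holomorphic chart `Θ` centred at `0` with `φ u = φ 0 + (Θ u) ^ m` near `0`
(output as in `exists_holomorphicPowChart`, the containing open set being some neighbourhood of `0`).
[cite: Forster1981, §2 Cor. 2.9 (local normal form)] [cite: ArnoldGuseinZadeVarchenko1985, §11.1 (normal form A_k)] -/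
theorem exists_holomorphicPowChart_of_analyticOrderAt {m : ℕ} (hm : 1 ≤ m) {φ : ℂ → ℂ} (hφ : AnalyticAt ℂ φ 0)
    (hord : analyticOrderAt (fun u => φ u - φ 0) 0 = m) :
    ∃ Θ : OpenPartialHomeomorph ℂ ℂ,
      (0 : ℂ) ∈ Θ.source ∧ Θ 0 = 0 ∧
      DifferentiableOn ℂ Θ Θ.source ∧ ContDiffOn ℝ ∞ Θ Θ.source ∧ ContDiffOn ℝ ∞ Θ.symm Θ.target ∧
      deriv Θ 0 ≠ 0 ∧
      ∀ u ∈ Θ.source, φ u = φ 0 + (Θ u) ^ m := by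
  have hφ' : AnalyticAt ℂ (fun u => φ u - φ 0) 0 := hφ.sub analyticAt_const
  obtain ⟨g, hg, hg0, hev⟩ := hφ'.analyticOrderAt_eq_natCast.1 hord
  -- an open ball on which `g` is holomorphic and the factorisation holds
  obtain ⟨U, hUmem, hUo, hUg⟩ : ∃ U ∈ 𝓝 (0 : ℂ), IsOpen U ∧ (AnalyticOnNhd ℂ g U ∧ ∀ u ∈ U, φ u - φ 0 = (u - 0) ^ m • g u) := by
    obtain ⟨s, hs, hsg⟩ := hg.exists_mem_nhds_analyticOnNhd
    obtain ⟨U, hUsub, hUo, h0U⟩ := mem_nhds_iff.1 (Filter.inter_mem hs hev)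
    exact ⟨U, hUo.mem_nhds h0U, hUo, hsg.mono fun u hu => (hUsub hu).1, fun u hu => (hUsub hu).2⟩
  have h0U : (0 : ℂ) ∈ U := mem_of_mem_nhds hUmem
  have hfac : ∀ u ∈ U, φ u = φ 0 + u ^ m * g u := fun u hu => by
    have h := hUg.2 u hu
    rw [sub_zero, smul_eq_mul] at h
    rw [← h]; ring
  obtain ⟨Θ, h0, hΘ0, -, hd, hC, hsC, hder, hnf⟩ :=
    exists_holomorphicPowChart hm hUo h0U hUg.1.differentiableOn hg0 hfac
  refine ⟨Θ, h0, hΘ0, hd, hC, hsC, ?_, hnf⟩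
  intro hz
  rw [hz, zero_pow (by omega)] at hder
  exact hg0 hder.symm

end Literature.Geometry.ComplexAnalytic

end
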